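import Mathlib
import Summits.MatrixMultiplication.MatrixMultiplication.Theses.MatrixPointInterpolation
import Summits.MatrixMultiplication.MatrixMultiplication.Theorems.TightWindows.Negative.ShiftCornerMasquerade
import Summits.MatrixMultiplication.MatrixMultiplication.Theorems.TightWindows.Negative.WindowDimUnbounded
import Summits.MatrixMultiplication.MatrixMultiplication.Theorems.MatrixPointInterpolationFewPointStrength
import Summits.MatrixMultiplication.MatrixMultiplication.Theorems.LongMasquerade.Negative.WindowedKaplanskyTwo

/-!
# Ladder sketch under the crux-top `LongMasquerade` (stmt-MatrixMultiplication-18938)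

Forward generator G4 `ladder-down`, unit `fwd-ladder-MatrixMultiplication-52` (planner folder file;
published as a crux workfile, never a proposal).  It TYPES the gradation of the crux in its own
language and records which rungs are already theorems of the tree.

* `Gen n d A`            — words of length `≤ d` in the pair `A` span `M_n(ℂ)`;
* `MasqAs k n D A`       — `A` satisfies every identity of `M_k(ℂ)` on words of length `≤ D`;
* `ShadowThrough k n D N A B` — evaluation at `A` on words of length `≤ D` factors through the
  `N` points `B t ∈ M_k(ℂ)²` (the successor crux's currency).

Gradation parameters of `LongMasquerade = ∃ k ≥ 2, MasqueradeAt k`: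
1. point size `k`            (`MasqueradeAt k`; antitone direction: larger `k` is weaker);
2. generation speed `d ≤ f n` (`MasqueradeAtSpeed k f`);
3. window ratio `r`          (`MasqueradeRatio k r`, the crux has `r = 2`);
4. point-count exponent `ε`  (`FewPointFamily ε`; the successor crux
   `FewPointMasquerades = ∀ ε > 0, FewPointFamily ε`).

VERDICT typed below: the TOP is a theorem (`longMasquerade_holds_sketch`, from the landed
`TightWindowsNeg.shiftPair_gen` / `shiftPair_masq`: `k = 5`, `d = 2m+1`, the shift/corner pair), so
every rung BELOW it is settled (flat ladder); the `k`-rungs `MasqueradeAt 3`, `MasqueradeAt 4` and the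
speed rungs are ABOVE the top (they imply it by `⟨k, _, h⟩`), hence off-path for G4; the point-count
ladder belongs to the successor crux and is calibrated by `fewPointFamily_calibration`
(`FewPointFamily ε → ω ≤ 2 + ε`, landed) — its only known host, the shift pair, is an
`n^5`-point shadow *exactly* (`ShiftPairFiveSlotLower`, `ShiftPairGridUpper` below; proof sketches in
LADDER-LongMasquerade.md §4), i.e. it certifies `ω ≤ 5`, not `ω ≤ 3` as the slot-rank note
(`N k³ ≥ n³`) and the route text ("expected N ≳ n³") suggest.
-/

set_option linter.dupNamespace false

namespace Summit.MatrixMultiplication.MatrixMultiplication.Cruxes.LongMasquerade.Ladder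

open Summit.MatrixMultiplication.MatrixMultiplication.Theses.MatrixPointInterpolation
open Summit.MatrixMultiplication.MatrixMultiplication.Theorems
open Literature.Computability.AlgebraicComplexity

/-! ## The three predicates of the crux's own language -/

/-- Words of length `≤ d` in the pair `A` span `M_n(ℂ)`. -/
def Gen (n d : ℕ) (A : Fin 2 → Matrix (Fin n) (Fin n) ℂ) : Prop :=
  Submodule.span ℂ {M : Matrix (Fin n) (Fin n) ℂ |
    ∃ w : List (Fin 2), w.length ≤ d ∧ (w.map A).prod = M} = ⊤

/-- `A` satisfies every identity of `M_k(ℂ)` supported on words of length `≤ D`. -/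
def MasqAs (k n D : ℕ) (A : Fin 2 → Matrix (Fin n) (Fin n) ℂ) : Prop :=
  ∀ (T : Finset (List (Fin 2))) (c : List (Fin 2) → ℂ), (∀ w ∈ T, w.length ≤ D) →
    (∀ B : Fin 2 → Matrix (Fin k) (Fin k) ℂ, (∑ w ∈ T, c w • (w.map B).prod) = 0) →
    (∑ w ∈ T, c w • (w.map A).prod) = 0

/-- Evaluation at `A` on words of length `≤ D` factors through the `N` points `B t`. -/
def ShadowThrough (k n D N : ℕ) (A : Fin 2 → Matrix (Fin n) (Fin n) ℂ)
    (B : Fin N → Fin 2 → Matrix (Fin k) (Fin k) ℂ) : Prop :=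
  ∀ (T : Finset (List (Fin 2))) (c : List (Fin 2) → ℂ), (∀ w ∈ T, w.length ≤ D) →
    (∀ t : Fin N, (∑ w ∈ T, c w • (w.map (B t)).prod) = 0) →
    (∑ w ∈ T, c w • (w.map A).prod) = 0

/-- A shadow through points of size `k` is in particular a masquerade as `M_k`. -/
theorem masqAs_of_shadowThrough {k n D N : ℕ} {A : Fin 2 → Matrix (Fin n) (Fin n) ℂ}
    {B : Fin N → Fin 2 → Matrix (Fin k) (Fin k) ℂ} (h : ShadowThrough k n D N A B) :
    MasqAs k n D A :=
  fun T c hT hB => h T c hT fun t => hB (B t)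

/-- Shrinking the window is free. -/
theorem masqAs_mono {k n D D' : ℕ} {A : Fin 2 → Matrix (Fin n) (Fin n) ℂ} (hD : D' ≤ D)
    (h : MasqAs k n D A) : MasqAs k n D' A :=
  fun T c hT hB => h T c (fun w hw => (hT w hw).trans hD) hB

/-! ## Parameter 1 — point size `k` -/

/-- Rung `LM(k)`: long masquerades with point size exactly `k`. -/
def MasqueradeAt (k : ℕ) : Prop :=
  ∀ n₀ : ℕ, ∃ (n d : ℕ) (A : Fin 2 → Matrix (Fin n) (Fin n) ℂ),
    n₀ ≤ n ∧ Gen n d A ∧ MasqAs k n (2 * d) A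

/-- The crux is literally `∃ k ≥ 2, LM(k)`. -/
theorem longMasquerade_iff : LongMasquerade ↔ ∃ k : ℕ, 2 ≤ k ∧ MasqueradeAt k := Iff.rfl

/-- Every `k`-rung with `2 ≤ k` sits ABOVE the top (costume direction for G4). -/
theorem longMasquerade_of_masqueradeAt {k : ℕ} (hk : 2 ≤ k) (h : MasqueradeAt k) :
    LongMasquerade := ⟨k, hk, h⟩

/-- `LM(2)` is refuted in the tree (`longMasquerade_two_false`, Hall identity + rank-one
commutator triangularisation, `n ≥ 6`). -/
theorem not_masqueradeAt_two : ¬ MasqueradeAt 2 := longMasquerade_two_false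

/-! ## Parameter 2 — generation speed, Parameter 3 — window ratio -/

/-- Rung `LM(k, f)`: as `LM(k)` with generation degree `d ≤ f n`. -/
def MasqueradeAtSpeed (k : ℕ) (f : ℕ → ℕ) : Prop :=
  ∀ n₀ : ℕ, ∃ (n d : ℕ) (A : Fin 2 → Matrix (Fin n) (Fin n) ℂ),
    n₀ ≤ n ∧ d ≤ f n ∧ Gen n d A ∧ MasqAs k n (2 * d) A

theorem masqueradeAt_of_speed {k : ℕ} {f : ℕ → ℕ} (h : MasqueradeAtSpeed k f) :
    MasqueradeAt k := fun n₀ => by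
  obtain ⟨n, d, A, hn, -, hg, hm⟩ := h n₀
  exact ⟨n, d, A, hn, hg, hm⟩

/-- Rung `LM(k; r)`: identities of `M_k` up to `r` times the generation degree. -/
def MasqueradeRatio (k r : ℕ) : Prop :=
  ∀ n₀ : ℕ, ∃ (n d : ℕ) (A : Fin 2 → Matrix (Fin n) (Fin n) ℂ),
    n₀ ≤ n ∧ Gen n d A ∧ MasqAs k n (r * d) A

theorem masqueradeRatio_two_iff (k : ℕ) : MasqueradeRatio k 2 ↔ MasqueradeAt k := Iff.rfl

theorem masqueradeRatio_anti {k r r' : ℕ} (hr : r' ≤ r) (h : MasqueradeRatio k r) :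
    MasqueradeRatio k r' := fun n₀ => by
  obtain ⟨n, d, A, hn, hg, hm⟩ := h n₀
  exact ⟨n, d, A, hn, hg, masqAs_mono (Nat.mul_le_mul_right d hr) hm⟩

/-- Typed rung (provable from the landed gap law `TightWindowsNeg.corner_pair_exists` and
`coeff_eq_zero_of_count_lt`, exactly as the attached candidate `LongMasqueradeCorner_v2.lean` does
for `(k, r) = (5, 2)`): every window ratio is reached by the shift pair at point size `2r+1`
(nonzero words with `j` corner letters have length `≥ j + (j-1)m > r(2m+1)` once `j ≥ 2r+1`).
Not toward `S`: the price is `k`, and `k` is free in `FewPointMasquerades`. -/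
def RatioClimb : Prop := ∀ r : ℕ, 1 ≤ r → MasqueradeRatio (2 * r + 1) r

/-! ## Floor witnesses: the TOP itself is a theorem of the tree -/

/-- FLOOR = TOP.  The shift pair `(N, E_{m,0})` of `M_{m+1}(ℂ)` generates in degree `2m+1 ≤ 2(m+1)`
and satisfies all identities of `M_5` up to degree `2(2m+1)` (landed:
`TightWindowsNeg.shiftPair_gen`, `TightWindowsNeg.shiftPair_masq`). -/
theorem masqueradeAtSpeed_five : MasqueradeAtSpeed 5 (fun n => 2 * n) := fun n₀ => by
  let N : Matrix (Fin (n₀ + 1)) (Fin (n₀ + 1)) ℂ :=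
    Matrix.of fun i j => if (j : ℕ) = (i : ℕ) + 1 then 1 else 0
  have hN : ∀ i j : Fin (n₀ + 1), N i j = if (j : ℕ) = (i : ℕ) + 1 then 1 else 0 :=
    fun i j => rfl
  exact ⟨n₀ + 1, 2 * n₀ + 1, ![N, Matrix.single (Fin.last n₀) 0 1], Nat.le_succ n₀,
    (show 2 * n₀ + 1 ≤ 2 * (n₀ + 1) by omega),
    TightWindowsNeg.shiftPair_gen N hN le_rfl, TightWindowsNeg.shiftPair_masq N hN⟩

theorem masqueradeAt_five : MasqueradeAt 5 := masqueradeAt_of_speed masqueradeAtSpeed_five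

/-- The crux-top, settled TRUE from landed lemmas (same proof as the attached candidate
`LongMasqueradeProof.lean`; the item is retriaged `support` and is outside the cone of `closes`). -/
theorem longMasquerade_holds_sketch : LongMasquerade :=
  longMasquerade_of_masqueradeAt (by norm_num) masqueradeAt_five

/-- Hence the `k`-ladder reads: `LM(2)` false, `LM(5), LM(6), …` true (monotone in `k` by corner
embedding — not formalised here), `LM(3)`, `LM(4)` OPEN — both strengthenings of a theorem. -/
theorem kLadder_summary : ¬ MasqueradeAt 2 ∧ MasqueradeAt 5 ∧ LongMasquerade :=
  ⟨not_masqueradeAt_two, masqueradeAt_five, longMasquerade_holds_sketch⟩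

/-! ## Parameter 4 — point-count exponent (the successor crux `FewPointMasquerades`) -/

/-- Rung `FP(ε)`: a few-point family at ONE accuracy `ε` (point size `k` fixed along the family). -/
def FewPointFamily (ε : ℝ) : Prop :=
  ∃ k : ℕ, ∀ n₀ : ℕ, ∃ (n d N : ℕ) (A : Fin 2 → Matrix (Fin n) (Fin n) ℂ)
    (B : Fin N → Fin 2 → Matrix (Fin k) (Fin k) ℂ),
    n₀ ≤ n ∧ (N : ℝ) ≤ (n : ℝ) ^ ((2 : ℝ) + ε) ∧ Gen n d A ∧ ShadowThrough k n (2 * d) N A B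

/-- The successor crux is literally `∀ ε > 0, FP(ε)`. -/
theorem fewPointMasquerades_iff :
    FewPointMasquerades ↔ ∀ ε : ℝ, 0 < ε → FewPointFamily ε := Iff.rfl

/-- LADDER CALIBRATION (landed `omega_le_two_add_of_fewPointFamily`): the rung `FP(ε)` is worth
exactly `ω(ℂ) ≤ 2 + ε`; rungs with `ε ≥ 1` are ω-inert, `ε < 0.3714` would beat the record. -/
theorem fewPointFamily_calibration {ε : ℝ} (h : FewPointFamily ε) : omega ℂ ≤ 2 + ε := by
  obtain ⟨k, hfam⟩ := h
  exact omega_le_two_add_of_fewPointFamily hfam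

/-- Every point-count rung lies BELOW the top in the weak sense `FP(ε) → (∃ k, LM(k))`
(forgetting the points); the `2 ≤ k` side condition is recovered from `not_masqueradeAt_two`-type
facts (`k = 0, 1` hosts are impossible for `n ≥ 2`; not formalised here). -/
theorem masqueradeAt_of_fewPointFamily {ε : ℝ} (h : FewPointFamily ε) : ∃ k, MasqueradeAt k := by
  obtain ⟨k, hfam⟩ := h
  refine ⟨k, fun n₀ => ?_⟩
  obtain ⟨n, d, N, A, B, hn, -, hg, hs⟩ := hfam n₀
  exact ⟨n, d, A, hn, hg, masqAs_of_shadowThrough hs⟩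

/-- First explicit rung of the point-count ladder: polynomially many points, some exponent.
COVERED (not filed): `LongMasquerade` + landed `pointCount_proof` + the registered stub
`stub_genericGrowthPolyUpper` (`Cruxes/FewPointMasquerades/Lines/fast_masquerades.lean`, vendored
fact `GenericMatricesQuasiPolynomialGrowth.upper`) + `d_min ≤ n²` give it with `c = 2·k² + O(1)`. -/
def PolyPointShadows : Prop :=
  ∃ k c : ℕ, ∀ n₀ : ℕ, ∃ (n d N : ℕ) (A : Fin 2 → Matrix (Fin n) (Fin n) ℂ)
    (B : Fin N → Fin 2 → Matrix (Fin k) (Fin k) ℂ),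
    n₀ ≤ n ∧ N ≤ n ^ c ∧ Gen n d A ∧ ShadowThrough k n (2 * d) N A B

/-! ## The 5-slot calibration of the only known host (new; proofs sketched in LADDER §4)

For the shift pair of `M_{m+1}` with window `2(2m+1)`, the words
`x^{b₀} y x^{b₁} y x^{b₂} y x^{b₃} y x^{b₄}` evaluate to `[b₁=b₂=b₃=m]·E_{m-b₀,b₄}` and lie in the
window iff `b₀ + b₄ + 2 ≤ m`; every point functional on them factors through the algebra map
`ℂ[z₀,…,z₄] → M_k^{⊗5}`, `z^b ↦ ⊗ᵢ X_t^{bᵢ}` (image `≤ k⁵`), whose kernel is an IDEAL: a nonzero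
kernel element in the box `b ≤ (a,m,m,m,c)` can be shifted by a monomial onto the corner
`(a,m,m,m,c)` keeping total degree, which separates `A` from the points.  Conversely product grids of
roots of unity in `(diag ζ, upper shift) ∈ M_5²` realise an `O(m⁵)`-point shadow. -/

/-- LOWER BOUND (5-slot lemma): a shadow of the shift pair through `N` points of size `k` on the
window `2(2m+1)` forces `(a+1)(c+1)(m+1)³ ≤ N·k⁵` for all `a + c + 2 ≤ m`; with `a = c = ⌊(m-2)/2⌋`
this is `N ≥ (m+1)³⌊m/2⌋⌈m/2⌉ / k⁵ ≍ n⁵/(4k⁵)` — so at FIXED `k` the host is not an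
`n^{5-δ}`-point shadow (sharpens slot-rank's `N k³ ≥ n³`). -/
def ShiftPairFiveSlotLower : Prop :=
  ∀ (m k N a c : ℕ) (Nm : Matrix (Fin (m + 1)) (Fin (m + 1)) ℂ),
    (∀ i j : Fin (m + 1), Nm i j = if (j : ℕ) = (i : ℕ) + 1 then 1 else 0) →
    ∀ B : Fin N → Fin 2 → Matrix (Fin k) (Fin k) ℂ, a + c + 2 ≤ m →
    ShadowThrough k (m + 1) (2 * (2 * m + 1)) N ![Nm, Matrix.single (Fin.last m) 0 1] B →
    (a + 1) * (c + 1) * (m + 1) ^ 3 ≤ N * k ^ 5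

/-- UPPER BOUND (grid design at point size 5): the shift pair of `M_{m+1}` with window `2(2m+1)`
IS a shadow through at most `64(m+1)⁵` points `(diag ζ, upper shift) ∈ M_5(ℂ)²`
(`ζ` on product grids of roots of unity, one grid per number `j ≤ 4` of corner letters:
`m²(m+1)³ + (2m+1)⁴ + (3m+1)³ + (4m+2)² + (4m+3)` points). -/
def ShiftPairGridUpper : Prop :=
  ∀ (m : ℕ) (Nm : Matrix (Fin (m + 1)) (Fin (m + 1)) ℂ),
    (∀ i j : Fin (m + 1), Nm i j = if (j : ℕ) = (i : ℕ) + 1 then 1 else 0) →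
    ∃ (N : ℕ) (B : Fin N → Fin 2 → Matrix (Fin 5) (Fin 5) ℂ), N ≤ 64 * (m + 1) ^ 5 ∧
    ShadowThrough 5 (m + 1) (2 * (2 * m + 1)) N ![Nm, Matrix.single (Fin.last m) 0 1] B

/-- Calibration consequence (typed): the grid design puts the shift pair on the rung `FP(3 + δ)`
for every `δ > 0` (`64 n⁵ ≤ n^{5+δ}` for `n ≥ 64^{1/δ}`), worth `ω ≤ 5 + δ` — ω-inert. -/
theorem fewPointFamily_of_gridUpper (h : ShiftPairGridUpper) {δ : ℝ} (hδ : 0 < δ) :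
    FewPointFamily (3 + δ) := by
  refine ⟨5, fun n₀ => ?_⟩
  -- choose m + 1 ≥ max n₀ M with 64 ≤ (m+1)^δ
  obtain ⟨M, hM⟩ : ∃ M : ℕ, ∀ n : ℕ, M ≤ n → (64 : ℝ) ≤ (n : ℝ) ^ δ := by
    refine ⟨⌈(64 : ℝ) ^ (1 / δ)⌉₊ + 1, fun n hn => ?_⟩
    have h1 : (64 : ℝ) ^ (1 / δ) ≤ n := by
      have : (64 : ℝ) ^ (1 / δ) ≤ (⌈(64 : ℝ) ^ (1 / δ)⌉₊ + 1 : ℕ) := by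
        push_cast
        exact (Nat.le_ceil _).trans (le_add_of_nonneg_right zero_le_one)
      exact this.trans (by exact_mod_cast hn)
    have h64 : (0 : ℝ) ≤ (64 : ℝ) ^ (1 / δ) := by positivity
    calc (64 : ℝ) = ((64 : ℝ) ^ (1 / δ)) ^ δ := by
          rw [← Real.rpow_mul (by norm_num : (0 : ℝ) ≤ 64), one_div_mul_cancel hδ.ne',
            Real.rpow_one]
      _ ≤ (n : ℝ) ^ δ := Real.rpow_le_rpow h64 h1 hδ.le
  let m : ℕ := max n₀ M
  let Nm : Matrix (Fin (m + 1)) (Fin (m + 1)) ℂ :=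
    Matrix.of fun i j => if (j : ℕ) = (i : ℕ) + 1 then 1 else 0
  have hN : ∀ i j : Fin (m + 1), Nm i j = if (j : ℕ) = (i : ℕ) + 1 then 1 else 0 :=
    fun i j => rfl
  obtain ⟨N, B, hNle, hshadow⟩ := h m Nm hN
  refine ⟨m + 1, 2 * m + 1, N, ![Nm, Matrix.single (Fin.last m) 0 1], B, ?_, ?_,
    TightWindowsNeg.shiftPair_gen Nm hN le_rfl, hshadow⟩
  · exact (le_max_left n₀ M).trans (Nat.le_succ _)
  · have hm1 : (1 : ℝ) ≤ ((m + 1 : ℕ) : ℝ) := by exact_mod_cast Nat.succ_le_succ (Nat.zero_le m)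
    have hMm : M ≤ m + 1 := (le_max_right n₀ M).trans (Nat.le_succ _)
    have hpos : (0 : ℝ) < ((m + 1 : ℕ) : ℝ) := by positivity
    calc (N : ℝ) ≤ ((64 * (m + 1) ^ 5 : ℕ) : ℝ) := by exact_mod_cast hNle
      _ = 64 * ((m + 1 : ℕ) : ℝ) ^ (5 : ℝ) := by
          push_cast
          rw [show ((m : ℝ) + 1) ^ (5 : ℝ) = ((m : ℝ) + 1) ^ (5 : ℕ) from by
            exact_mod_cast Real.rpow_natCast ((m : ℝ) + 1) 5]
      _ ≤ ((m + 1 : ℕ) : ℝ) ^ δ * ((m + 1 : ℕ) : ℝ) ^ (5 : ℝ) := by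
          gcongr
          exact hM (m + 1) hMm
      _ = ((m + 1 : ℕ) : ℝ) ^ ((2 : ℝ) + (3 + δ)) := by
          rw [← Real.rpow_add hpos]; ring_nf

end Summit.MatrixMultiplication.MatrixMultiplication.Cruxes.LongMasquerade.Ladder
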